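import Mathlib
import HarnessLib
import Summits.Ventures.LatticeQCDFlow.Scaling.MetricTunnellingSectors

/-!
# LatticeQCDFlow / Scaling — the SPARSE-PATCH tunnelling law: local updates change the admissibility sector only through a thin plaquette at the patch (v3.2, charge-free)

HONEST FRAMING: exact (Metropolis-corrected) sampling algorithms for lattice gauge theory; figures
of merit are autocorrelation/cost numbers at stated couplings and volumes; no continuum-physics
claim.

THEORY-2.md §3.3 / conjecture C7(b) (the PATCH form of the intrinsic tunnelling law), ABSTRACT PART.
`Scaling/MetricTunnellingSectors.lean` prices SMALL-STEP samplers (HMC-type): the sector — the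
connected component of the admissible region — changes per stationary step with probability
`≤ 2·μ(r-neighbourhood of the defect set)`.  The production LOCAL algorithms (heat bath, overrelaxation,
link Metropolis, and parallel sweeps of non-interacting links) make LARGE moves of FEW links; this file
prices them.  Setting: configurations `U : E → Y` (`Y` a pseudo-metric space of link values), a family
of "plaquette defects" `a p : (E → Y) → ℝ`, `p : ι`, each reading the links `slot p s`, `s : S`, with

* `hlip`  — linkwise control: `a p V ≤ a p U + Σ_s dist (U (slot p s)) (V (slot p s))`;
* `hdet`  — detectability: every updated link `e` is a slot `s` of some `p` through which its
  displacement is read off when the other slots are frozen: `dist (U e) (V e) ≤ a p U + a p V`;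
* `hpath` — `(ρ, r)`-local paths in `Y` (a `ρ`-close pair of link values is joined inside the closed
  `r`-ball about the first);
* the update set `Λ ⊆ E` is PLAQUETTE-SPARSE: no `p` has two distinct slots in `Λ` (every single link
  for `L ≥ 2`; every set of links no two of which share a plaquette).

With thresholds `2c ≤ ρ`, `c + r ≤ ε` (admissibility level `ε`: the admissible region is
`{W | ∀ p, a p W < ε}`, its connected components are the SECTORS):

* `mem_connectedComponentIn_of_sparsePatch` — KEY LEMMA: if `U, V` agree off `Λ`, every plaquette
  touching `Λ` has defect `< c` in both, and `U` is admissible, then `V` lies in the sector of `U`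
  (interpolate each updated link along its local path; along the way a touched plaquette has defect
  `< c + r ≤ ε`, an untouched one is unchanged);
* `sparsePatch_separates` — hence a sparse-patch move that changes the sector starts or ends in the
  THIN-PLAQUETTE set `B_Λ(c) = {U | ∃ p s, slot p s ∈ Λ ∧ c ≤ a p U}`;
* **`compProd_sector_ne_le_of_sparsePatch`** — for every s-finite `μ` and every `μ`-invariant Markov
  kernel whose moves a.s. change only links in `Λ`: `(μ ⊗ₘ κ){sector ≠ sector'} ≤ 2·μ(B_Λ(c))`;
  **`measure_sector_ne_le_nsteps_of_sparsePatches`** — over `n` such steps (patches `Λ_k`, e.g. a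
  sweep) of a process with one-time marginals `m`: `P{sector(Z_n) ≠ sector(Z_0)} ≤ n·2·sup_k m(B_{Λ_k}(c))`;
  `measure_sparseBad_le_sum` — the union bound `m(B_Λ(c)) ≤ Σ_{p touching Λ} m{c ≤ a p}`.

The lattice instances (`SU(N)`, Wilson plaquettes on the periodic torus, `c = min(ε/3, r₀(N)/2)`) are
`Scaling/SparsePatchSectorsLattice.lean`.  No sorry, no new axioms, no `def`.
-/

noncomputable section

open scoped ENNReal ProbabilityTheory
open MeasureTheory ProbabilityTheory Metric Set
namespace Summit.Ventures.LatticeQCDFlow.Theory2.Tunnelling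

/-! ## §1. The key lemma and the separating set -/

section Separating

variable {E Y ι S : Type*} [PseudoMetricSpace Y] [Fintype S]

/-- **Key lemma (sparse patches stay in the sector).**  Configurations agreeing off a plaquette-sparse
link set `Λ`, with every plaquette touching `Λ` of defect `< c` in both and the first admissible at
level `ε`, lie in one connected component of the admissible region `{W | ∀ p, a p W < ε}` — provided
`Y` has `(ρ, r)`-local paths, `2c ≤ ρ` and `c + r ≤ ε`. [folklore] -/
theorem mem_connectedComponentIn_of_sparsePatch {a : ι → (E → Y) → ℝ} {slot : ι → S → E}
    (hlip : ∀ p (U V : E → Y), a p V ≤ a p U + ∑ s, dist (U (slot p s)) (V (slot p s)))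
    {Λ : Set E} (hsparse : ∀ p s s', slot p s ∈ Λ → slot p s' ∈ Λ → s = s')
    (hdet : ∀ e ∈ Λ, ∃ p s, slot p s = e ∧ ∀ U V : E → Y,
      (∀ s', s' ≠ s → U (slot p s') = V (slot p s')) → dist (U e) (V e) ≤ a p U + a p V)
    {ρ r : ℝ} (hr : 0 ≤ r)
    (hpath : ∀ y y' : Y, dist y y' ≤ ρ → ∃ γ : ℝ → Y, ContinuousOn γ (Icc (0 : ℝ) 1) ∧ γ 0 = y ∧
      γ 1 = y' ∧ ∀ t ∈ Icc (0 : ℝ) 1, dist (γ t) y ≤ r)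
    {c ε : ℝ} (hcρ : 2 * c ≤ ρ) (hcr : c + r ≤ ε)
    {U V : E → Y} (hUV : ∀ e ∉ Λ, U e = V e)
    (hU : ∀ p s, slot p s ∈ Λ → a p U < c) (hV : ∀ p s, slot p s ∈ Λ → a p V < c)
    (hUadm : ∀ p, a p U < ε) :
    V ∈ connectedComponentIn {W | ∀ p, a p W < ε} U := by
  classical
  -- the updated links move by at most `ρ`
  have hsmall : ∀ e ∈ Λ, dist (U e) (V e) ≤ ρ := by
    intro e he
    obtain ⟨p, s, hps, hb⟩ := hdet e he
    have hs : slot p s ∈ Λ := by rw [hps]; exact he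
    have hagree : ∀ s', s' ≠ s → U (slot p s') = V (slot p s') := by
      intro s' hs'
      by_cases h' : slot p s' ∈ Λ
      · exact absurd (hsparse p s' s h' hs) hs'
      · exact hUV _ h'
    have h1 := hb U V hagree
    have h2 := hU p s hs
    have h3 := hV p s hs
    linarith
  -- linkwise paths: the local path on updated links, the constant path elsewhere
  have hex : ∀ e, ∃ γ : ℝ → Y, ContinuousOn γ (Icc (0 : ℝ) 1) ∧ γ 0 = U e ∧ γ 1 = V e ∧
      (∀ t ∈ Icc (0 : ℝ) 1, dist (γ t) (U e) ≤ r) ∧ (e ∉ Λ → ∀ t, γ t = U e) := by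
    intro e
    by_cases he : e ∈ Λ
    · obtain ⟨γ, hγc, hγ0, hγ1, hγd⟩ := hpath (U e) (V e) (hsmall e he)
      exact ⟨γ, hγc, hγ0, hγ1, hγd, fun h => absurd he h⟩
    · exact ⟨fun _ => U e, continuousOn_const, rfl, hUV e he,
        fun t _ => by rw [dist_self]; exact hr, fun _ _ => rfl⟩
  choose γ hγc hγ0 hγ1 hγd hγconst using hex
  -- the configuration path
  set W : ℝ → (E → Y) := fun t e => γ e t with hW
  have hWc : ContinuousOn W (Icc (0 : ℝ) 1) := continuousOn_pi.2 fun e => hγc e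
  have hW0 : W 0 = U := funext fun e => hγ0 e
  have hW1 : W 1 = V := funext fun e => hγ1 e
  -- admissibility along the path
  have hadm : ∀ t ∈ Icc (0 : ℝ) 1, ∀ p, a p (W t) < ε := by
    intro t ht p
    have hl := hlip p U (W t)
    by_cases hp : ∃ s, slot p s ∈ Λ
    · obtain ⟨s, hs⟩ := hp
      have hsum : ∑ s', dist (U (slot p s')) (W t (slot p s')) ≤ r := by
        rw [Finset.sum_eq_single s]
        · show dist (U (slot p s)) (γ (slot p s) t) ≤ r
          rw [dist_comm]; exact hγd (slot p s) t ht
        · intro s' _ hs'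
          have h' : slot p s' ∉ Λ := fun h' => hs' (hsparse p s' s h' hs)
          show dist (U (slot p s')) (γ (slot p s') t) = 0
          rw [hγconst (slot p s') h' t, dist_self]
        · intro h; exact absurd (Finset.mem_univ s) h
      have := hU p s hs
      linarith
    · push Not at hp
      have hsum : ∑ s', dist (U (slot p s')) (W t (slot p s')) = 0 := by
        refine Finset.sum_eq_zero fun s' _ => ?_
        show dist (U (slot p s')) (γ (slot p s') t) = 0
        rw [hγconst (slot p s') (hp s') t, dist_self]
      have := hUadm p
      linarith
  have hsub : W '' Icc (0 : ℝ) 1 ⊆ {W | ∀ p, a p W < ε} := by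
    rintro _ ⟨t, ht, rfl⟩
    exact hadm t ht
  have h := (isPreconnected_Icc.image W hWc).subset_connectedComponentIn
    ⟨0, left_mem_Icc.2 zero_le_one, hW0⟩ hsub
  exact h ⟨1, right_mem_Icc.2 zero_le_one, hW1⟩

/-- **Separating lemma for sparse patches.**  A move that changes only the links of a plaquette-sparse
set `Λ` and changes the SECTOR (connected component of the admissible region at level `ε`) starts or
ends in the thin-plaquette set `{U | ∃ p s, slot p s ∈ Λ ∧ c ≤ a p U}`. [folklore] -/
theorem sparsePatch_separates {a : ι → (E → Y) → ℝ} {slot : ι → S → E}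
    (hlip : ∀ p (U V : E → Y), a p V ≤ a p U + ∑ s, dist (U (slot p s)) (V (slot p s)))
    {Λ : Set E} (hsparse : ∀ p s s', slot p s ∈ Λ → slot p s' ∈ Λ → s = s')
    (hdet : ∀ e ∈ Λ, ∃ p s, slot p s = e ∧ ∀ U V : E → Y,
      (∀ s', s' ≠ s → U (slot p s') = V (slot p s')) → dist (U e) (V e) ≤ a p U + a p V)
    {ρ r : ℝ} (hr : 0 ≤ r)
    (hpath : ∀ y y' : Y, dist y y' ≤ ρ → ∃ γ : ℝ → Y, ContinuousOn γ (Icc (0 : ℝ) 1) ∧ γ 0 = y ∧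
      γ 1 = y' ∧ ∀ t ∈ Icc (0 : ℝ) 1, dist (γ t) y ≤ r)
    {c ε : ℝ} (hcρ : 2 * c ≤ ρ) (hcr : c + r ≤ ε)
    {U V : E → Y} (hUV : ∀ e ∉ Λ, U e = V e)
    (hne : connectedComponentIn {W | ∀ p, a p W < ε} U ≠ connectedComponentIn {W | ∀ p, a p W < ε} V) :
    U ∈ {U : E → Y | ∃ p s, slot p s ∈ Λ ∧ c ≤ a p U} ∨
      V ∈ {U : E → Y | ∃ p s, slot p s ∈ Λ ∧ c ≤ a p U} := by
  by_contra h
  simp only [mem_setOf_eq, not_or, not_exists, not_and, not_le] at h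
  obtain ⟨hU, hV⟩ := h
  by_cases hUadm : ∀ p, a p U < ε
  · exact hne (connectedComponentIn_eq
      (mem_connectedComponentIn_of_sparsePatch hlip hsparse hdet hr hpath hcρ hcr hUV hU hV hUadm))
  · push Not at hUadm
    obtain ⟨p, hp⟩ := hUadm
    have hc : c ≤ ε := by linarith
    have hpΛ : ∀ s, slot p s ∉ Λ := fun s hs => absurd (hU p s hs) (not_lt.2 (hc.trans hp))
    have hVp : ε ≤ a p V := by
      have hl := hlip p V U
      have hsum : ∑ s, dist (V (slot p s)) (U (slot p s)) = 0 :=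
        Finset.sum_eq_zero fun s _ => by rw [hUV _ (hpΛ s), dist_self]
      linarith
    have hUe : connectedComponentIn {W : E → Y | ∀ p, a p W < ε} U = ∅ :=
      connectedComponentIn_eq_empty fun h => (not_lt.2 hp) (h p)
    have hVe : connectedComponentIn {W : E → Y | ∀ p, a p W < ε} V = ∅ :=
      connectedComponentIn_eq_empty fun h => (not_lt.2 hVp) (h p)
    exact hne (hUe.trans hVe.symm)

omit [PseudoMetricSpace Y] [Fintype S] in
/-- The admissible region is the complement of the defect set `{W | ∃ p, ε ≤ a p W}` (so the sectors
here are the `connectedComponentIn Dᶜ` of `Scaling/MetricTunnellingSectors.lean`). [folklore] -/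
theorem compl_setOf_exists_le_eq {a : ι → (E → Y) → ℝ} {ε : ℝ} :
    {W : E → Y | ∃ p, ε ≤ a p W}ᶜ = {W | ∀ p, a p W < ε} := by
  ext W
  simp only [mem_compl_iff, mem_setOf_eq, not_exists, not_le]

end Separating

/-! ## §2. The laws -/

section Laws

variable {E Y ι S : Type*} [PseudoMetricSpace Y] [Fintype S] [MeasurableSpace (E → Y)]

/-- **Sparse-patch tunnelling law (one step).**  For every s-finite `μ`, every `μ`-invariant Markov
kernel `κ` whose moves a.s. change only links of the plaquette-sparse set `Λ`, and thresholds
`2c ≤ ρ`, `c + r ≤ ε`:  `(μ ⊗ₘ κ){sector ≠ sector'} ≤ 2·μ{∃ p touching Λ, c ≤ a p}`. [folklore] -/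
theorem compProd_sector_ne_le_of_sparsePatch {a : ι → (E → Y) → ℝ} {slot : ι → S → E}
    (hlip : ∀ p (U V : E → Y), a p V ≤ a p U + ∑ s, dist (U (slot p s)) (V (slot p s)))
    {Λ : Set E} (hsparse : ∀ p s s', slot p s ∈ Λ → slot p s' ∈ Λ → s = s')
    (hdet : ∀ e ∈ Λ, ∃ p s, slot p s = e ∧ ∀ U V : E → Y,
      (∀ s', s' ≠ s → U (slot p s') = V (slot p s')) → dist (U e) (V e) ≤ a p U + a p V)
    {ρ r : ℝ} (hr : 0 ≤ r)
    (hpath : ∀ y y' : Y, dist y y' ≤ ρ → ∃ γ : ℝ → Y, ContinuousOn γ (Icc (0 : ℝ) 1) ∧ γ 0 = y ∧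
      γ 1 = y' ∧ ∀ t ∈ Icc (0 : ℝ) 1, dist (γ t) y ≤ r)
    {c ε : ℝ} (hcρ : 2 * c ≤ ρ) (hcr : c + r ≤ ε)
    (μ : Measure (E → Y)) [SFinite μ] (κ : Kernel (E → Y) (E → Y)) [IsMarkovKernel κ]
    (hinv : κ.Invariant μ) (hΛ : ∀ᵐ q ∂(μ ⊗ₘ κ), ∀ e ∉ Λ, q.1 e = q.2 e) :
    (μ ⊗ₘ κ) {q | connectedComponentIn {W | ∀ p, a p W < ε} q.1 ≠
        connectedComponentIn {W | ∀ p, a p W < ε} q.2} ≤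
      2 * μ {U | ∃ p s, slot p s ∈ Λ ∧ c ≤ a p U} :=
  compProd_chargeChange_le_of_invariant (R := fun U V : E → Y => ∀ e ∉ Λ, U e = V e)
    (Q := fun U : E → Y => connectedComponentIn {W | ∀ p, a p W < ε} U)
    (B := {U : E → Y | ∃ p s, slot p s ∈ Λ ∧ c ≤ a p U})
    (fun _ _ hUV hne => sparsePatch_separates hlip hsparse hdet hr hpath hcρ hcr hUV hne) μ κ hinv hΛ

/-- **Sparse-patch tunnelling law with an exceptional set** (moves touching links outside `Λ` allowed
on a set whose `μ ⊗ₘ κ`-mass is added). [folklore] -/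
theorem compProd_sector_ne_le_of_sparsePatch_add {a : ι → (E → Y) → ℝ} {slot : ι → S → E}
    (hlip : ∀ p (U V : E → Y), a p V ≤ a p U + ∑ s, dist (U (slot p s)) (V (slot p s)))
    {Λ : Set E} (hsparse : ∀ p s s', slot p s ∈ Λ → slot p s' ∈ Λ → s = s')
    (hdet : ∀ e ∈ Λ, ∃ p s, slot p s = e ∧ ∀ U V : E → Y,
      (∀ s', s' ≠ s → U (slot p s') = V (slot p s')) → dist (U e) (V e) ≤ a p U + a p V)
    {ρ r : ℝ} (hr : 0 ≤ r)
    (hpath : ∀ y y' : Y, dist y y' ≤ ρ → ∃ γ : ℝ → Y, ContinuousOn γ (Icc (0 : ℝ) 1) ∧ γ 0 = y ∧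
      γ 1 = y' ∧ ∀ t ∈ Icc (0 : ℝ) 1, dist (γ t) y ≤ r)
    {c ε : ℝ} (hcρ : 2 * c ≤ ρ) (hcr : c + r ≤ ε)
    (μ : Measure (E → Y)) [SFinite μ] (κ : Kernel (E → Y) (E → Y)) [IsMarkovKernel κ]
    (hinv : κ.Invariant μ) :
    (μ ⊗ₘ κ) {q | connectedComponentIn {W | ∀ p, a p W < ε} q.1 ≠
        connectedComponentIn {W | ∀ p, a p W < ε} q.2} ≤
      2 * μ {U | ∃ p s, slot p s ∈ Λ ∧ c ≤ a p U} + (μ ⊗ₘ κ) {q | ¬ ∀ e ∉ Λ, q.1 e = q.2 e} :=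
  compProd_chargeChange_le_add_of_invariant (R := fun U V : E → Y => ∀ e ∉ Λ, U e = V e)
    (Q := fun U : E → Y => connectedComponentIn {W | ∀ p, a p W < ε} U)
    (B := {U : E → Y | ∃ p s, slot p s ∈ Λ ∧ c ≤ a p U})
    (fun _ _ hUV hne => sparsePatch_separates hlip hsparse hdet hr hpath hcρ hcr hUV hne) μ κ hinv

/-- **`n`-step / sweep law.**  A process `Z` with all one-time marginals `m` whose `k`-th step a.s.
changes only links of the plaquette-sparse set `Λ k` (a sweep of single-link or non-interacting-link
updates) changes its sector over `n` steps with probability `≤ n·2·M`, `M ≥ m{∃ p touching Λ k, c ≤ a p}`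
for all `k`. [folklore] -/
theorem measure_sector_ne_le_nsteps_of_sparsePatches {a : ι → (E → Y) → ℝ} {slot : ι → S → E}
    (hlip : ∀ p (U V : E → Y), a p V ≤ a p U + ∑ s, dist (U (slot p s)) (V (slot p s)))
    {Λ : ℕ → Set E} (hsparse : ∀ k p s s', slot p s ∈ Λ k → slot p s' ∈ Λ k → s = s')
    (hdet : ∀ k, ∀ e ∈ Λ k, ∃ p s, slot p s = e ∧ ∀ U V : E → Y,
      (∀ s', s' ≠ s → U (slot p s') = V (slot p s')) → dist (U e) (V e) ≤ a p U + a p V)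
    {ρ r : ℝ} (hr : 0 ≤ r)
    (hpath : ∀ y y' : Y, dist y y' ≤ ρ → ∃ γ : ℝ → Y, ContinuousOn γ (Icc (0 : ℝ) 1) ∧ γ 0 = y ∧
      γ 1 = y' ∧ ∀ t ∈ Icc (0 : ℝ) 1, dist (γ t) y ≤ r)
    {c ε : ℝ} (hcρ : 2 * c ≤ ρ) (hcr : c + r ≤ ε)
    {Ω : Type*} [MeasurableSpace Ω] (P : Measure Ω) (Z : ℕ → Ω → (E → Y))
    (hZ : ∀ k, Measurable (Z k)) (m : Measure (E → Y)) (hmarg : ∀ k, P.map (Z k) = m)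
    (hstep : ∀ k, ∀ᵐ ω ∂P, ∀ e ∉ Λ k, Z k ω e = Z (k + 1) ω e) {M : ℝ≥0∞}
    (hM : ∀ k, m {U | ∃ p s, slot p s ∈ Λ k ∧ c ≤ a p U} ≤ M) (n : ℕ) :
    P {ω | connectedComponentIn {W | ∀ p, a p W < ε} (Z n ω) ≠
        connectedComponentIn {W | ∀ p, a p W < ε} (Z 0 ω)} ≤ n * (2 * M) := by
  refine measure_chargeChange_le_nsteps (R := fun k (U V : E → Y) => ∀ e ∉ Λ k, U e = V e)
    (Q := fun U : E → Y => connectedComponentIn {W | ∀ p, a p W < ε} U)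
    (B := fun k => {U : E → Y | ∃ p s, slot p s ∈ Λ k ∧ c ≤ a p U})
    (fun k _ _ hUV hne => sparsePatch_separates hlip (hsparse k) (hdet k) hr hpath hcρ hcr hUV hne)
    P Z hstep (fun k => ?_) n
  have h1 : ∀ j, P (Z j ⁻¹' {U : E → Y | ∃ p s, slot p s ∈ Λ k ∧ c ≤ a p U}) ≤ M := fun j => by
    calc P (Z j ⁻¹' {U : E → Y | ∃ p s, slot p s ∈ Λ k ∧ c ≤ a p U})
        ≤ P.map (Z j) {U : E → Y | ∃ p s, slot p s ∈ Λ k ∧ c ≤ a p U} :=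
          Measure.le_map_apply (hZ j).aemeasurable _
      _ ≤ M := by rw [hmarg j]; exact hM k
  calc P (Z k ⁻¹' {U : E → Y | ∃ p s, slot p s ∈ Λ k ∧ c ≤ a p U}) +
        P (Z (k + 1) ⁻¹' {U : E → Y | ∃ p s, slot p s ∈ Λ k ∧ c ≤ a p U}) ≤ M + M :=
        add_le_add (h1 k) (h1 (k + 1))
    _ = 2 * M := (two_mul M).symm

omit [PseudoMetricSpace Y] [Fintype S] in
/-- **Union bound for the thin-plaquette set**: `m{∃ p touching Λ, c ≤ a p} ≤ Σ_{p ∈ T} m{c ≤ a p}`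
for any finite `T` containing every plaquette with a slot in `Λ` (with a translation-invariant `m`,
`#T ×` the one-plaquette tail). [folklore] -/
theorem measure_sparseBad_le_sum {a : ι → (E → Y) → ℝ} {slot : ι → S → E} {Λ : Set E} {c : ℝ}
    (m : Measure (E → Y)) (T : Finset ι) (hT : ∀ p s, slot p s ∈ Λ → p ∈ T) :
    m {U | ∃ p s, slot p s ∈ Λ ∧ c ≤ a p U} ≤ ∑ p ∈ T, m {U | c ≤ a p U} := by
  calc m {U | ∃ p s, slot p s ∈ Λ ∧ c ≤ a p U} ≤ m (⋃ p ∈ T, {U : E → Y | c ≤ a p U}) := by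
        refine measure_mono fun U hU => ?_
        obtain ⟨p, s, hs, hc⟩ := hU
        exact Set.mem_iUnion₂.2 ⟨p, hT p s hs, hc⟩
    _ ≤ ∑ p ∈ T, m {U | c ≤ a p U} := measure_biUnion_finset_le T _

end Laws

end Summit.Ventures.LatticeQCDFlow.Theory2.Tunnelling
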